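import Literature.Analysis.ValidatedNumerics.Certificate
import Literature.NumberTheory.Sieve.ParityWave0

/-!
# Numerical verification of the even Goldbach conjecture — a kernel-checked initial segment

`Literature.NumberTheory.Sieve.goldbach_of_le` (parity.S16) records the result of Oliveira e Silva, Herzog and Pardi
(Math. Comp. 83 (2014) 2033–2060, abstract): the even Goldbach conjecture is confirmed for all
even numbers not larger than `4·10¹⁸`.  It was obtained by an exhaustive distributed computation —
a segmented sieve of Eratosthenes and, for each even `N` of a segment, a search for the *minimal
Goldbach partition* `N = p + q` (least prime `p`).  (Scale, as reported by the authors and not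
re-checked here — the paper is not held by this library, whose upstream locator for the fact is
"Theorem 1": about 782 single-core CPU-years, double-checked up to `4·10¹⁷`.)  No proof other
than re-running a computation of that size is known, so the fact is not dischargeable in the
Lean kernel; it stays a named fact.

This file makes the structure of the fact explicit and proves, *inside the kernel*, an initial
segment sized to the library's elaboration budget, by the standard verification scheme ("method
B" of Richstein, Math. Comp. 70 (2000), §1: cover the even numbers of `[a, b]` by `P₁ + P₂` with
`P₁` the primes `≤ δ` and `P₂` the primes of `[a - δ, b]`, the latter generated segment by segment
by a sieve of Eratosthenes on a bit array of odd numbers, §§2–3, each segment preceded by an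
overlap of length `δ`, §2):

* `GoldbachUpTo B` — every even `4 ≤ N ≤ B` is a sum of two primes; `goldbach_of_le` unfolds,
  definitionally, to `GoldbachUpTo (4 * 10 ^ 18)` (`Iff.rfl` proves the equivalence, so it is
  not restated), `GoldbachUpTo` is monotone in `B`, and it follows from `GoldbachConjecture`.
* `GoldbachSieve.check` — a verified checker implementing that scheme in miniature: a bit-mask
  sieve of Eratosthenes on a window of odd numbers (all masks are `ℕ` literals, so the kernel's
  GMP-backed `Nat` bit operations do the work), followed by the covering step "every even `N` of
  the window is `p + q` with `p ≤ K` an odd prime and `q` unsieved".  Its soundness theorem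
  `GoldbachSieve.sound` is proved once and for all; each window then costs one `decide +kernel`.
* `GoldbachSieve.chain`, `goldbachVerifier : Literature.Verifier ℕ GoldbachUpTo` — certificate chains
  and the T-VALNUM verifier interface of `Literature.Analysis.ValidatedNumerics.Certificate`
  (`GoldbachUpTo` is the named hypothesis, a certificate is a list of windows), with the small
  end-to-end instance `goldbachUpTo_ten_pow_four` checked in the kernel.
* The companion leaf file `Literature/NumberTheory/Sieve/GoldbachVerificationCertificates.lean`
  chains twenty windows of `5·10⁶` integers into `goldbachUpTo_ten_pow_eight : GoldbachUpTo
  (10 ^ 8)` — the range reached by Stein–Stein in 1965 (Math. Comp. 19, p. 433, note added in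
  proof), a `2.5·10⁻¹¹` fraction of the cited one; the heavy kernel evaluations live there so
  that this API file stays cheap to rebuild.

Cost model for certificates (measured with this tree's toolchain, one core).  Kernel *memory*
dominates: every intermediate literal of a kernel evaluation stays cached until its declaration
is checked, about `0.6 · π(√N) · R` bytes for a window of `R` integers at height `N` (`+0.9 GB`
for `[0, 5·10⁶]`, `+3.7 GB` for `5·10⁶` integers at `10⁸`), so a window must be one declaration
and `R · π(√N)` should stay near `6·10⁹`; kernel time is secondary (`≈ 1 s` per `10⁶` integers at
`10⁸`; 2–6 s per window, 85 s for the twenty windows run sequentially).  Reaching `10⁹` this way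
would take an estimated 450 windows and 40 minutes of kernel time; `4·10¹⁸` is out of reach of
any kernel evaluation.

## References
* T. Oliveira e Silva, S. Herzog, S. Pardi, *Empirical verification of the even Goldbach
  conjecture and computation of prime gaps up to 4·10¹⁸*, Math. Comp. 83 (2014), 2033–2060,
  doi:10.1090/S0025-5718-2013-02787-1 — abstract (statement of the verification; minimal Goldbach
  partitions; text checked against zbMATH Zbl 1290.11161).
  [cite: OliveiraSilvaHerzogPardi2014, Abstract]
* J. Richstein, *Verifying the Goldbach conjecture up to 4·10¹⁴*, Math. Comp. 70 (2000),
  1745–1749 — §1 (methods A and B), §2 (segmentation, overlap `δ`), §3 (segmented sieve of the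
  odd numbers as bit arrays), §4 (verification). [cite: Richstein2000, §§1–4]
* M. L. Stein, P. R. Stein, *Experimental results on additive 2-bases*, Math. Comp. 19 (1965),
  427–434 — p. 433, note added in proof: verification of Goldbach's conjecture up to `10⁸` by a
  sieve. [cite: SteinStein1965, p. 433]
-/

namespace Literature.NumberTheory.Sieve

/-! ### The bounded Goldbach property -/

/-- `GoldbachUpTo B`: every even `N` with `4 ≤ N ≤ B` is a sum of two primes — the shape of
every published numerical verification of Goldbach's conjecture (Pipping 1938: `10⁵`; Stein–Stein
1965: `10⁸`; …; Oliveira e Silva–Herzog–Pardi 2014: `4·10¹⁸`).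
[cite: OliveiraSilvaHerzogPardi2014, Abstract] -/
def GoldbachUpTo (B : ℕ) : Prop :=
  ∀ N : ℕ, Even N → 4 ≤ N → N ≤ B → ∃ p q : ℕ, p.Prime ∧ q.Prime ∧ p + q = N

/-- `GoldbachUpTo` is monotone in the bound. [folklore] -/
theorem GoldbachUpTo.mono {B B' : ℕ} (h : GoldbachUpTo B') (hB : B ≤ B') : GoldbachUpTo B :=
  fun N hN h4 hle => h N hN h4 (hle.trans hB)

/-- The full conjecture gives every bounded instance. [folklore] -/
theorem GoldbachUpTo.of_goldbachConjecture (h : GoldbachConjecture) (B : ℕ) : GoldbachUpTo B :=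
  fun N hN h4 _ => h N hN h4

/-- In particular `GoldbachConjecture → goldbach_of_le` (the fact is, definitionally,
`GoldbachUpTo (4 * 10 ^ 18)`). [folklore] -/
theorem goldbach_of_le_of_goldbachConjecture (h : GoldbachConjecture) : goldbach_of_le :=
  fun N hN h4 _ => h N hN h4

/-- The base case `4 = 2 + 2`. [folklore] -/
theorem goldbachUpTo_four : GoldbachUpTo 4 := by
  intro N _ h4 hle
  obtain rfl : N = 4 := le_antisymm hle h4
  exact ⟨2, 2, Nat.prime_two, Nat.prime_two, rfl⟩

/-- Extending a verified range by a verified block. [folklore] -/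
theorem GoldbachUpTo.extend {B B' : ℕ} (h : GoldbachUpTo B)
    (h' : ∀ N : ℕ, Even N → B < N → N ≤ B' → ∃ p q : ℕ, p.Prime ∧ q.Prime ∧ p + q = N) :
    GoldbachUpTo B' := fun N hN h4 hle => by
  by_cases hNB : N ≤ B
  · exact h N hN h4 hNB
  · exact h' N hN (Nat.lt_of_not_le hNB) hle

/-! ### A verified bit-mask Goldbach checker -/

namespace GoldbachSieve

/-! #### Bit-mask primitives

All masks are natural numbers; bit `i` of `C` is `C.testBit i`.  The computational definitions
use only operations the kernel evaluates with GMP (`+ - * / %`, `&&& ||| <<< >>>`, `Nat.beq`,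
`Nat.ble`), never `2 ^ n` (use `1 <<< n`). -/

/-- `repMaskAux d fuel m` (for `m < 2 ^ fuel`): the mask with bits `0, d, 2d, …, (m-1)d`, built
by binary splitting of `m` (so with `O(log m)` shifts and ors). [folklore] -/
def repMaskAux (d : ℕ) : ℕ → ℕ → ℕ
  | 0, _ => 0
  | fuel + 1, m =>
    if m = 0 then 0
    else
      let h := repMaskAux d fuel (m / 2)
      let h₂ := h ||| (h <<< (d * (m / 2)))
      if m % 2 = 0 then h₂ else h₂ ||| (1 <<< (d * (m - 1)))

/-- `repMask d m`: the mask with bits `0, d, 2d, …, (m-1)d`. [folklore] -/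
def repMask (d m : ℕ) : ℕ := repMaskAux d m m

/-- Bits of `repMaskAux`. [folklore] -/
theorem testBit_repMaskAux {d : ℕ} (hd : 0 < d) :
    ∀ (fuel m : ℕ), m < 2 ^ fuel → ∀ i : ℕ,
      (repMaskAux d fuel m).testBit i = decide (d ∣ i ∧ i < d * m)
  | 0, m, hm, i => by
    obtain rfl : m = 0 := by simpa using hm
    simp [repMaskAux]
  | fuel + 1, m, hm, i => by
    simp only [repMaskAux]
    split_ifs with h0 hpar
    · subst h0; simp
    · obtain ⟨q, rfl⟩ : ∃ q, m = 2 * q := ⟨m / 2, by omega⟩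
      have hq : 2 * q / 2 = q := by omega
      have ih := testBit_repMaskAux hd fuel q (by rw [Nat.pow_succ] at hm; omega)
      have hdK : d ∣ d * q := dvd_mul_right d q
      have h2K : d * (2 * q) = d * q + d * q := by ring
      rw [hq, h2K, Bool.eq_iff_iff]
      generalize d * q = K at *
      simp only [Nat.testBit_or, Nat.testBit_shiftLeft, ih, Bool.or_eq_true, Bool.and_eq_true,
        decide_eq_true_eq]
      constructor
      · rintro (⟨h1, h2⟩ | ⟨h1, h2, h3⟩)
        · exact ⟨h1, by omega⟩
        · have := Nat.dvd_add h2 hdK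
          rw [Nat.sub_add_cancel h1] at this
          exact ⟨this, by omega⟩
      · rintro ⟨h1, h2⟩
        by_cases h : K ≤ i
        · exact Or.inr ⟨h, Nat.dvd_sub h1 hdK, by omega⟩
        · exact Or.inl ⟨h1, by omega⟩
    · obtain ⟨q, rfl⟩ : ∃ q, m = 2 * q + 1 := ⟨m / 2, by omega⟩
      have hq : (2 * q + 1) / 2 = q := by omega
      have ih := testBit_repMaskAux hd fuel q (by rw [Nat.pow_succ] at hm; omega)
      have hdK : d ∣ d * q := dvd_mul_right d q
      have h2K : d * (2 * q + 1) = d * q + d * q + d := by ring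
      have h2K' : d * (2 * q + 1 - 1) = d * q + d * q := by
        rw [Nat.add_sub_cancel]; ring
      rw [hq, h2K, h2K', Bool.eq_iff_iff]
      generalize d * q = K at *
      simp only [Nat.testBit_or, Nat.testBit_shiftLeft, ih, Nat.one_shiftLeft, Nat.testBit_two_pow,
        Bool.or_eq_true, Bool.and_eq_true, decide_eq_true_eq]
      constructor
      · rintro ((⟨h1, h2⟩ | ⟨h1, h2, h3⟩) | h)
        · exact ⟨h1, by omega⟩
        · have := Nat.dvd_add h2 hdK
          rw [Nat.sub_add_cancel h1] at this
          exact ⟨this, by omega⟩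
        · subst h
          exact ⟨Nat.dvd_add hdK hdK, by omega⟩
      · rintro ⟨h1, h2⟩
        by_cases h : K ≤ i
        · by_cases h' : i < K + K
          · exact Or.inl (Or.inr ⟨h, Nat.dvd_sub h1 hdK, by omega⟩)
          · have h3 : d ∣ i - (K + K) := Nat.dvd_sub h1 (Nat.dvd_add hdK hdK)
            have h4 : i - (K + K) = 0 := Nat.eq_zero_of_dvd_of_lt h3 (by omega)
            exact Or.inr (by omega)
        · exact Or.inl (Or.inl ⟨h1, by omega⟩)

/-- Bits of `repMask`: bit `i` is set iff `d ∣ i` and `i < d m`. [folklore] -/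
theorem testBit_repMask {d : ℕ} (hd : 0 < d) (m i : ℕ) :
    (repMask d m).testBit i = decide (d ∣ i ∧ i < d * m) :=
  testBit_repMaskAux hd m m Nat.lt_two_pow_self i

/-- Bit test via `land` with a one-bit mask (keeps kernel intermediates small). [folklore] -/
def bitClear (C i : ℕ) : Bool := C &&& (1 <<< i) == 0

/-- `bitClear C i` is the negation of `C.testBit i`. [folklore] -/
theorem bitClear_eq (C i : ℕ) : bitClear C i = !C.testBit i := by
  rw [bitClear, Nat.one_shiftLeft, Bool.eq_iff_iff, beq_iff_eq, Bool.not_eq_true']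
  constructor
  · intro h
    have := congrArg (fun x => Nat.testBit x i) h
    simpa [Nat.testBit_and, Nat.testBit_two_pow] using this
  · intro h
    apply Nat.eq_of_testBit_eq
    intro k
    rw [Nat.testBit_and, Nat.testBit_two_pow, Nat.zero_testBit]
    by_cases hk : i = k
    · subst hk; simp [h]
    · simp [hk]

/-- Round `x` up to a multiple of `d`. [folklore] -/
def roundUp (x d : ℕ) : ℕ := (x + d - 1) / d * d

/-- `x ≤ roundUp x d`. [folklore] -/
theorem le_roundUp (x : ℕ) {d : ℕ} (hd : 0 < d) : x ≤ roundUp x d := by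
  have := Nat.lt_div_mul_add (a := x + d - 1) hd
  rw [roundUp]; omega

/-- `roundUp x d` is the least multiple of `d` above `x`. [folklore] -/
theorem roundUp_le {x d y : ℕ} (hd : 0 < d) (hdy : d ∣ y) (hxy : x ≤ y) : roundUp x d ≤ y := by
  obtain ⟨k, rfl⟩ := hdy
  rw [roundUp, mul_comm d k]
  refine Nat.mul_le_mul_right d ?_
  by_contra h
  replace h : k + 1 ≤ (x + d - 1) / d := Nat.lt_of_not_le h
  have h' : (k + 1) * d ≤ x + d - 1 := (Nat.le_div_iff_mul_le hd).1 h
  rw [add_mul, one_mul, mul_comm] at h'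
  omega

/-- `progMask d lo L W`: the offsets `j ≤ W` (relative to `L`) of the members `L + j` of the
progression `d ∣ ·` that are `≥ lo`. [folklore] -/
def progMask (d lo L W : ℕ) : ℕ :=
  let a := roundUp (max lo L) d
  if L + W < a then 0 else repMask d ((L + W - a) / d + 1) <<< (a - L)

/-- Bits of `progMask`. [folklore] -/
theorem testBit_progMask {d : ℕ} (hd : 0 < d) (lo L W j : ℕ) :
    (progMask d lo L W).testBit j = decide (d ∣ L + j ∧ lo ≤ L + j ∧ j ≤ W) := by
  simp only [progMask]
  generalize ha : roundUp (max lo L) d = a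
  have hdvd : d ∣ a := ha ▸ dvd_mul_left d _
  have hle : max lo L ≤ a := ha ▸ le_roundUp (max lo L) hd
  have hmin : ∀ y, d ∣ y → max lo L ≤ y → a ≤ y :=
    fun y h1 h2 => ha ▸ roundUp_le hd h1 h2
  split_ifs with hlt
  · rw [Nat.zero_testBit, eq_comm, decide_eq_false_iff_not]
    rintro ⟨h1, h2, h3⟩
    have := hmin (L + j) h1 (by omega)
    omega
  · replace hlt : a ≤ L + W := Nat.le_of_not_lt hlt
    rw [Nat.testBit_shiftLeft, testBit_repMask hd, Bool.eq_iff_iff]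
    simp only [Bool.and_eq_true, decide_eq_true_eq, ge_iff_le]
    obtain ⟨q, hq⟩ := hdvd
    have hmaxL : L ≤ a := le_trans (le_max_right lo L) hle
    have hmaxlo : lo ≤ a := le_trans (le_max_left lo L) hle
    constructor
    · rintro ⟨h1, ⟨c, hc⟩, h3⟩
      refine ⟨⟨q + c, ?_⟩, by omega, ?_⟩
      · rw [mul_add, ← hq, ← hc]; omega
      · have h3' : d * c < d * ((L + W - a) / d + 1) := hc ▸ h3
        have hc' : c < (L + W - a) / d + 1 := Nat.lt_of_mul_lt_mul_left h3'
        have hdc : d * c ≤ L + W - a := by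
          have h5 := Nat.div_mul_le_self (L + W - a) d
          have h4 : c ≤ (L + W - a) / d := by omega
          calc d * c ≤ d * ((L + W - a) / d) := Nat.mul_le_mul_left d h4
            _ ≤ L + W - a := by rw [mul_comm]; exact h5
        omega
    · rintro ⟨h1, h2, h3⟩
      have hay : a ≤ L + j := hmin (L + j) h1 (max_le h2 (Nat.le_add_right L j))
      have hsub : d ∣ L + j - a := Nat.dvd_sub h1 ⟨q, hq⟩
      have hj : j - (a - L) = L + j - a := by omega
      refine ⟨by omega, hj ▸ hsub, ?_⟩
      obtain ⟨c, hc⟩ := hsub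
      rw [hj, hc]
      refine Nat.mul_lt_mul_of_pos_left ?_ hd
      have : c ≤ (L + W - a) / d := by
        rw [Nat.le_div_iff_mul_le hd]
        calc c * d = L + j - a := by rw [mul_comm]; omega
          _ ≤ L + W - a := by omega
      omega

/-- The odd-coordinate progression mask: for odd `d`, even `L` and odd `lo`, the offsets
`t ≤ T` of the odd numbers `L + 1 + 2t` that are divisible by `d` and `≥ lo`.  (Consecutive odd
multiples of `d` are `d` apart in `t`; the change of origin `L' = (d+1)/2 · (L+1)` uses that
`(d+1)/2` is the inverse of `2` modulo `d`.) [folklore] -/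
def oddProgMask (d lo L T : ℕ) : ℕ :=
  let L' := (d + 1) / 2 * (L + 1)
  progMask d (L' + (lo - (L + 1)) / 2) L' T

/-- Bits of `oddProgMask`. [folklore] -/
theorem testBit_oddProgMask {d lo L : ℕ} (hd : d % 2 = 1) (hlo : lo % 2 = 1) (hL : L % 2 = 0)
    (T t : ℕ) :
    (oddProgMask d lo L T).testBit t = decide (d ∣ L + 1 + 2 * t ∧ lo ≤ L + 1 + 2 * t ∧ t ≤ T) := by
  simp only [oddProgMask]
  rw [testBit_progMask (by omega)]
  have h2 : (d + 1) / 2 * 2 = d + 1 := Nat.div_mul_cancel (by omega)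
  have key : d ∣ (d + 1) / 2 * (L + 1) + t ↔ d ∣ L + 1 + 2 * t := by
    constructor
    · intro h
      have h' : d ∣ 2 * ((d + 1) / 2 * (L + 1) + t) := Dvd.dvd.mul_left h 2
      have e : 2 * ((d + 1) / 2 * (L + 1) + t) = d * (L + 1) + (L + 1 + 2 * t) := by
        have h3 : 2 * ((d + 1) / 2 * (L + 1) + t) = (d + 1) / 2 * 2 * (L + 1) + 2 * t := by ring
        rw [h3, h2]; ring
      rw [e] at h'
      have h'' := Nat.dvd_sub h' (dvd_mul_right d (L + 1))
      rwa [Nat.add_sub_cancel_left] at h''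
    · intro h
      have h' : d ∣ (d + 1) / 2 * (L + 1 + 2 * t) := Dvd.dvd.mul_left h _
      have e : (d + 1) / 2 * (L + 1 + 2 * t) = (d + 1) / 2 * (L + 1) + t + d * t := by
        have h3 : (d + 1) / 2 * (L + 1 + 2 * t) = (d + 1) / 2 * (L + 1) + (d + 1) / 2 * 2 * t := by
          ring
        rw [h3, h2]; ring
      rw [e] at h'
      have h'' := Nat.dvd_sub h' (dvd_mul_right d t)
      rwa [Nat.add_sub_cancel] at h''
  rw [Bool.eq_iff_iff]
  simp only [decide_eq_true_eq]
  rw [key]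
  constructor
  · rintro ⟨h1, h3, h4⟩
    exact ⟨h1, by omega, h4⟩
  · rintro ⟨h1, h3, h4⟩
    exact ⟨h1, by omega, h4⟩

/-! #### Folding masks over a list -/

/-- Bits of an `|||`-fold: a bit is set iff it was set initially or some member sets it.
[folklore] -/
theorem testBit_foldl_or_iff (g : ℕ → ℕ) (j : ℕ) :
    ∀ (l : List ℕ) (acc : ℕ), (l.foldl (fun C d => C ||| g d) acc).testBit j = true ↔
      acc.testBit j = true ∨ ∃ d ∈ l, (g d).testBit j = true
  | [], acc => by simp
  | d :: l, acc => by
    rw [List.foldl_cons, testBit_foldl_or_iff g j l, Nat.testBit_or, Bool.or_eq_true]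
    constructor
    · rintro ((h | h) | ⟨d', hd', h⟩)
      · exact Or.inl h
      · exact Or.inr ⟨d, List.mem_cons_self, h⟩
      · exact Or.inr ⟨d', List.mem_cons_of_mem d hd', h⟩
    · rintro (h | ⟨d', hd', h⟩)
      · exact Or.inl (Or.inl h)
      · rcases List.mem_cons.1 hd' with rfl | hd'
        · exact Or.inl (Or.inr h)
        · exact Or.inr ⟨d', hd', h⟩

/-! #### The base sieve: primes up to `s` -/

/-- The sieve of Eratosthenes on `[0, s]` by every `d ∈ [2, r]` (composite `d` included —
harmless and cheap at this size), with `0` and `1` flagged: for `s < (r+1)²`, bit `i ≤ s` is clear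
iff `i` is prime. [folklore] -/
def baseSieve (r s : ℕ) : ℕ :=
  (List.range' 2 (r - 1)).foldl (fun C d => C ||| progMask d (2 * d) 0 s) 0 ||| 3

/-- Every flagged number is `0`, `1` or composite. [folklore] -/
theorem not_prime_of_testBit_baseSieve {r s i : ℕ} (h : (baseSieve r s).testBit i = true) :
    ¬i.Prime := by
  rw [baseSieve, Nat.testBit_or, Bool.or_eq_true] at h
  rcases h with h | h
  · obtain ⟨d, hd, h⟩ := ((testBit_foldl_or_iff _ i _ 0).1 h).resolve_left (by simp)
    rw [List.mem_range'_1] at hd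
    rw [testBit_progMask (by omega), decide_eq_true_iff, zero_add] at h
    exact Nat.not_prime_of_dvd_of_lt h.1 (by omega) (by omega)
  · have hi : i < 2 := by
      have := (Nat.testBit_two_pow_sub_one 2 i).symm.trans
        (show Nat.testBit (2 ^ 2 - 1) i = true from h)
      simpa using this
    interval_cases i <;> decide

/-- With `s < (r+1)²`, every unflagged `i ≤ s` is prime. [folklore] -/
theorem prime_of_testBit_baseSieve {r s i : ℕ} (hs : s < (r + 1) * (r + 1)) (hi : i ≤ s)
    (h : (baseSieve r s).testBit i = false) : i.Prime := by
  rw [baseSieve, Nat.testBit_or, Bool.or_eq_false_iff] at h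
  have h2 : 2 ≤ i := by
    have := (Nat.testBit_two_pow_sub_one 2 i).symm.trans
      (show Nat.testBit (2 ^ 2 - 1) i = false from h.2)
    simp at this; omega
  by_contra hp
  have ha := Nat.minFac_prime (show i ≠ 1 by omega)
  have hsq := Nat.minFac_sq_le_self (by omega : 0 < i) hp
  have har : Nat.minFac i ≤ r := by
    by_contra h'
    have h'' : r + 1 ≤ Nat.minFac i := by omega
    have := Nat.mul_le_mul h'' h''
    rw [pow_two] at hsq
    omega
  obtain ⟨k, hk⟩ := Nat.minFac_dvd i
  have hk2 : 2 ≤ k := by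
    by_contra hk'
    interval_cases k
    · omega
    · rw [mul_one] at hk
      exact hp (hk ▸ ha)
  have hbit : ((List.range' 2 (r - 1)).foldl (fun C d => C ||| progMask d (2 * d) 0 s) 0).testBit
      i = true := by
    refine (testBit_foldl_or_iff _ i _ 0).2 (Or.inr ⟨Nat.minFac i, ?_, ?_⟩)
    · rw [List.mem_range'_1]
      have := ha.two_le
      omega
    · rw [testBit_progMask ha.pos, decide_eq_true_iff, zero_add]
      refine ⟨⟨k, hk⟩, ?_, hi⟩
      calc 2 * Nat.minFac i ≤ k * Nat.minFac i := Nat.mul_le_mul_right _ hk2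
        _ = i := by rw [mul_comm]; exact hk.symm
  rw [h.1] at hbit
  exact Bool.false_ne_true hbit

/-- `primesIn B a n`: the members of `[a, a + n)` not flagged by `B`, in increasing order.
[folklore] -/
def primesIn (B a n : ℕ) : List ℕ :=
  (List.range' a n).filter fun i => bitClear B i

/-- Membership in `primesIn`. [folklore] -/
theorem mem_primesIn {B a n p : ℕ} :
    p ∈ primesIn B a n ↔ (a ≤ p ∧ p < a + n) ∧ B.testBit p = false := by
  simp [primesIn, bitClear_eq]

/-! #### The window sieve on odd numbers -/

/-- The odd window sieve: bit `t ≤ T` stands for the odd number `L + 1 + 2t` (`L` even) and is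
set iff some `d ∈ ps` divides it with `3d ≤ L + 1 + 2t` (the segment bit array of odd numbers of
Richstein's §3, as one `ℕ` literal). [cite: Richstein2000, §3] -/
def oddSieve (ps : List ℕ) (L T : ℕ) : ℕ :=
  ps.foldl (fun C d => C ||| oddProgMask d (3 * d) L T) 0

/-- **Soundness of the window sieve.**  If `ps` contains every odd prime `≤ s`, `L` is even and
`L + 1 + 2T < (s+1)²`, then an unmarked `t ≤ T` with `3 ≤ L + 1 + 2t` is a prime `L + 1 + 2t`.
(No hypothesis on the other members of `ps` is needed: extra members only mark more.) [folklore] -/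
theorem prime_of_testBit_oddSieve {ps : List ℕ} {L T s t : ℕ} (hL : L % 2 = 0)
    (hps : ∀ p : ℕ, p.Prime → 3 ≤ p → p ≤ s → p ∈ ps)
    (hs : L + 1 + 2 * T < (s + 1) * (s + 1)) (ht : t ≤ T) (h3 : 3 ≤ L + 1 + 2 * t)
    (hbit : (oddSieve ps L T).testBit t = false) : (L + 1 + 2 * t).Prime := by
  by_contra hp
  set n := L + 1 + 2 * t with hn
  have ha := Nat.minFac_prime (show n ≠ 1 by omega)
  have hsq := Nat.minFac_sq_le_self (by omega : 0 < n) hp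
  obtain ⟨k, hk⟩ := Nat.minFac_dvd n
  have has : Nat.minFac n ≤ s := by
    by_contra h'
    have h'' : s + 1 ≤ Nat.minFac n := by omega
    have := Nat.mul_le_mul h'' h''
    rw [pow_two] at hsq
    omega
  have ha2 : Nat.minFac n ≠ 2 := by
    intro h2
    have : 2 ∣ n := h2 ▸ Nat.minFac_dvd n
    omega
  have ha3 : 3 ≤ Nat.minFac n := by
    have := ha.two_le
    omega
  have haodd : Nat.minFac n % 2 = 1 := by
    rcases ha.eq_two_or_odd' with h | h
    · exact absurd h ha2
    · exact Nat.odd_iff.1 h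
  have hka : Nat.minFac n ≤ k := by
    by_contra hlt
    replace hlt : k < Nat.minFac n := Nat.lt_of_not_le hlt
    have : Nat.minFac n * k < Nat.minFac n * Nat.minFac n := Nat.mul_lt_mul_of_pos_left hlt ha.pos
    rw [← hk, pow_two] at *
    omega
  have hmem := hps _ ha ha3 has
  have hbit' : (oddSieve ps L T).testBit t = true := by
    refine (testBit_foldl_or_iff _ t ps 0).2 (Or.inr ⟨Nat.minFac n, hmem, ?_⟩)
    rw [testBit_oddProgMask haodd (by omega) hL, decide_eq_true_iff, ← hn]
    refine ⟨⟨k, hk⟩, ?_, ht⟩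
    calc 3 * Nat.minFac n ≤ k * Nat.minFac n := Nat.mul_le_mul_right _ (le_trans ha3 hka)
      _ = n := by rw [mul_comm]; exact hk.symm
  rw [hbit] at hbit'
  exact Bool.false_ne_true hbit'

/-! #### Covering the even numbers -/

/-- The covering accumulator on `u ≤ T` (bit `u` stands for the even number `L + 2u`): bit `u`
survives iff for no `p ∈ cs` with `(p+1)/2 ≤ u` the odd number `L + 2u - p`, i.e. offset
`u - (p+1)/2` of the window, is unmarked in `Q` — the check `{2n} ⊆ P₁ + P₂` of Richstein's
method B (§1, §4), done for all `u` at once by shifting the window mask.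
[cite: Richstein2000, §§1, 4] -/
def cover (Q T : ℕ) (cs : List ℕ) : ℕ :=
  cs.foldl (fun acc p => acc &&& ((Q <<< ((p + 1) / 2)) ||| ((1 <<< ((p + 1) / 2)) - 1)))
    ((1 <<< (T + 1)) - 1)

/-- What a cleared bit of the covering fold means. [folklore] -/
theorem exists_of_testBit_cover_foldl {Q u : ℕ} : ∀ (cs : List ℕ) (acc : ℕ),
    (cs.foldl (fun acc p => acc &&& ((Q <<< ((p + 1) / 2)) ||| ((1 <<< ((p + 1) / 2)) - 1)))
        acc).testBit u = false →
      acc.testBit u = false ∨ ∃ p ∈ cs, (p + 1) / 2 ≤ u ∧ Q.testBit (u - (p + 1) / 2) = false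
  | [], _, h => Or.inl h
  | p :: cs, acc, h => by
    rw [List.foldl_cons] at h
    rcases exists_of_testBit_cover_foldl cs _ h with h | ⟨p', hp', h1, h2⟩
    · rw [Nat.testBit_and, Bool.and_eq_false_iff] at h
      rcases h with h | h
      · exact Or.inl h
      · rw [Nat.testBit_or, Bool.or_eq_false_iff, Nat.testBit_shiftLeft, Nat.one_shiftLeft,
          Nat.testBit_two_pow_sub_one, decide_eq_false_iff_not, not_lt] at h
        refine Or.inr ⟨p, List.mem_cons_self, h.2, ?_⟩
        simpa [h.2] using h.1
    · exact Or.inr ⟨p', List.mem_cons_of_mem p hp', h1, h2⟩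

/-- A cleared bit `u ≤ T` of `cover Q T cs` yields `p ∈ cs` with offset `u - (p+1)/2` unmarked.
[folklore] -/
theorem exists_of_testBit_cover {Q T u : ℕ} {cs : List ℕ} (hu : u ≤ T)
    (h : (cover Q T cs).testBit u = false) :
    ∃ p ∈ cs, (p + 1) / 2 ≤ u ∧ Q.testBit (u - (p + 1) / 2) = false := by
  rcases exists_of_testBit_cover_foldl cs _ h with h | h
  · rw [Nat.one_shiftLeft, Nat.testBit_two_pow_sub_one] at h
    simp at h; omega
  · exact h

/-- The target bits `u₀ ≤ u ≤ T`. [folklore] -/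
def targets (T u₀ : ℕ) : ℕ := ((1 <<< (T + 1)) - 1) >>> u₀ <<< u₀

/-- Bits of `targets`. [folklore] -/
theorem testBit_targets (T u₀ u : ℕ) : (targets T u₀).testBit u = decide (u₀ ≤ u ∧ u ≤ T) := by
  rw [targets, Nat.testBit_shiftLeft, Nat.testBit_shiftRight, Nat.one_shiftLeft,
    Nat.testBit_two_pow_sub_one]
  by_cases h : u₀ ≤ u
  · by_cases h' : u ≤ T
    · rw [decide_eq_true (show u ≥ u₀ from h), decide_eq_true (show u₀ + (u - u₀) < T + 1 by omega),
        decide_eq_true ⟨h, h'⟩]; rfl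
    · rw [decide_eq_false (show ¬(u₀ + (u - u₀) < T + 1) by omega),
        decide_eq_false (show ¬(u₀ ≤ u ∧ u ≤ T) from fun hh => h' hh.2), Bool.and_false]
  · rw [decide_eq_false (show ¬(u ≥ u₀) from h),
      decide_eq_false (show ¬(u₀ ≤ u ∧ u ≤ T) from fun hh => h hh.1), Bool.false_and]

/-! #### The checker -/

/-- **The Goldbach window checker.**  Window: the odd numbers `L + 1 + 2t`, `t ≤ T` (`L` even);
targets: the even `N` with `N₀ ≤ N`, `L ≤ N ≤ L + 2T`; `r`, `s`: sieve bounds with `s < (r+1)²`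
and `L + 1 + 2T < (s+1)²`; `K ≤ s`: bound for the small primes.  It accepts only when every
target is `p + q` with `3 ≤ p ≤ K` prime and `q` an unsieved member of the window (`sound`; the
converse is neither needed nor proved) — method B of Richstein
(§1: `P₁` = primes `≤ δ`, `P₂` = primes of the segment, with the segment starting `δ` below its
first target, §2), the scheme also underlying the minimal-Goldbach-partition search of
Oliveira e Silva–Herzog–Pardi, here with the kernel's `Nat` literals as bit arrays.
[cite: Richstein2000, §§1–4] -/
def check (L T N₀ r s K : ℕ) : Bool :=
  let base := baseSieve r s
  let Q := oddSieve (primesIn base 3 (s - 2)) L T ||| (if L = 0 then 1 else 0)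
  decide (L % 2 = 0) && decide (s < (r + 1) * (r + 1)) &&
    decide (L + 1 + 2 * T < (s + 1) * (s + 1)) && decide (K ≤ s) &&
      (cover Q T (primesIn base 3 (K - 2)) &&& targets T ((N₀ + 1 - L) / 2) == 0)

/-- **Soundness of the checker**: an accepted window certifies every even `N` with `N₀ ≤ N` and
`L ≤ N ≤ L + 2T`. [folklore] -/
theorem sound {L T N₀ r s K : ℕ} (h : check L T N₀ r s K = true) :
    ∀ N : ℕ, Even N → N₀ ≤ N → L ≤ N → N ≤ L + 2 * T →
      ∃ p q : ℕ, p.Prime ∧ q.Prime ∧ p + q = N := by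
  intro N hN hN₀ hLN hNT
  simp only [check, Bool.and_eq_true, decide_eq_true_eq, beq_iff_eq] at h
  obtain ⟨⟨⟨⟨hL, hr⟩, hs⟩, hK⟩, hcov⟩ := h
  have hN2 : N % 2 = 0 := Nat.even_iff.1 hN
  -- the sieving primes: every odd prime `≤ s` is unflagged in the base sieve
  have hps : ∀ p : ℕ, p.Prime → 3 ≤ p → p ≤ s → p ∈ primesIn (baseSieve r s) 3 (s - 2) :=
    fun p hp h3 hps => by
    rw [mem_primesIn]
    refine ⟨⟨h3, by omega⟩, ?_⟩
    cases hb : (baseSieve r s).testBit p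
    · rfl
    · exact absurd hp (not_prime_of_testBit_baseSieve hb)
  -- the target bit `u`
  set u := (N - L) / 2 with hu
  have hNu : N = L + 2 * u := by omega
  have huT : u ≤ T := by omega
  have htgt : (targets T ((N₀ + 1 - L) / 2)).testBit u = true := by
    rw [testBit_targets, decide_eq_true_iff]
    exact ⟨by omega, huT⟩
  have hc : (cover (oddSieve (primesIn (baseSieve r s) 3 (s - 2)) L T ||| if L = 0 then 1 else 0) T
      (primesIn (baseSieve r s) 3 (K - 2))).testBit u = false := by
    have := congrArg (fun x => Nat.testBit x u) hcov
    simpa only [Nat.testBit_and, Nat.zero_testBit, htgt, Bool.and_true] using this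
  obtain ⟨p, hp, hpu, hq⟩ := exists_of_testBit_cover huT hc
  rw [Nat.testBit_or, Bool.or_eq_false_iff] at hq
  -- `p` is an odd prime `≤ K`
  have hp' := mem_primesIn.1 hp
  have hpP : p.Prime := prime_of_testBit_baseSieve hr (by omega) hp'.2
  have hp2 : p % 2 = 1 := by
    rcases hpP.eq_two_or_odd' with h2 | h2
    · omega
    · exact Nat.odd_iff.1 h2
  -- `q = L + 1 + 2 (u - (p+1)/2)` is an unsieved odd number `≥ 3` of the window, hence prime
  have h3 : 3 ≤ L + 1 + 2 * (u - (p + 1) / 2) := by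
    by_cases hL0 : L = 0
    · subst hL0
      have h1 := hq.2
      simp only [if_true] at h1
      have hne : u - (p + 1) / 2 ≠ 0 := by
        intro h0
        rw [h0] at h1
        exact absurd h1 (by decide)
      omega
    · omega
  have hqP := prime_of_testBit_oddSieve hL hps hs (by omega) h3 hq.1
  exact ⟨p, _, hpP, hqP, by omega⟩

end GoldbachSieve

/-- **One verified window extends the verified range**: from `GoldbachUpTo B` and an accepted
window starting at an even `L ≤ B + 1` with targets `N ≥ B + 1`, Goldbach holds up to `L + 2T`.
[folklore] -/
theorem GoldbachUpTo.step {B : ℕ} (L T r s K : ℕ) (h : GoldbachUpTo B) (hL : L ≤ B + 1)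
    (hc : GoldbachSieve.check L T (B + 1) r s K = true) : GoldbachUpTo (L + 2 * T) :=
  h.extend fun N hN hBN hNT => GoldbachSieve.sound hc N hN hBN (by omega) hNT

/-! ### Certificate chains and the verifier interface -/

namespace GoldbachSieve

/-- Running a list of windows `(L, T, r, s, K)` in order from a certified bound `B`: each window
must start at an even `L ≤ B + 1` and be accepted with targets `N ≥ B + 1`; the bound then
becomes `L + 2T`.  Returns the final bound, or `none` if some window is rejected. [folklore] -/
def chain : ℕ → List (ℕ × ℕ × ℕ × ℕ × ℕ) → Option ℕ
  | B, [] => some B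
  | B, (L, T, r, s, K) :: ws =>
    if L ≤ B + 1 ∧ check L T (B + 1) r s K = true then chain (L + 2 * T) ws else none

/-- **Soundness of certificate chains.** [folklore] -/
theorem chain_sound : ∀ (B : ℕ) (ws : List (ℕ × ℕ × ℕ × ℕ × ℕ)) {B' : ℕ},
    chain B ws = some B' → GoldbachUpTo B → GoldbachUpTo B'
  | B, [], B', h, hB => by
    simp only [chain, Option.some.injEq] at h
    exact h ▸ hB
  | B, (L, T, r, s, K) :: ws, B', h, hB => by
    simp only [chain] at h
    split_ifs at h with hc
    exact chain_sound _ ws h (hB.step L T r s K hc.1 hc.2)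

end GoldbachSieve

/-- **The Goldbach verifier** in the sense of `Literature.Analysis.ValidatedNumerics.Verifier` (the T-VALNUM named-hypothesis
pattern of `Literature.Analysis.ValidatedNumerics.Certificate`, with `GoldbachUpTo` as the named
hypothesis): a certificate for `GoldbachUpTo B` is a list of windows, run by `GoldbachSieve.chain`
from the bound `4` (`goldbachUpTo_four`), that reaches at least `B`.  Usage:
`goldbachVerifier.claim ws (by decide +kernel)`.  For ranges beyond a few `10⁶` chain one window
per declaration instead (as in `GoldbachVerificationCertificates.lean`): a single kernel
evaluation keeps every intermediate literal of all its windows alive. [folklore] -/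
def goldbachVerifier : Literature.Analysis.ValidatedNumerics.Verifier ℕ GoldbachUpTo where
  Cert := List (ℕ × ℕ × ℕ × ℕ × ℕ)
  check B ws := (GoldbachSieve.chain 4 ws).elim false fun B' => decide (B ≤ B')
  sound B ws h := by
    cases hch : GoldbachSieve.chain 4 ws with
    | none => simp [hch] at h
    | some B' =>
      rw [hch] at h
      simp only [Option.elim, decide_eq_true_eq] at h
      exact (GoldbachSieve.chain_sound 4 ws hch goldbachUpTo_four).mono h

/-- A small end-to-end instance of the verifier interface: Goldbach up to `10⁴` from the single
window `(L, T, r, s, K) = (0, 5000, 15, 200, 200)`, checked in the kernel. [folklore] -/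
theorem goldbachUpTo_ten_pow_four : GoldbachUpTo (10 ^ 4) :=
  goldbachVerifier.claim (i := 10 ^ 4) [(0, 5000, 15, 200, 200)] (by decide +kernel)

end Literature.NumberTheory.Sieve
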